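import Mathlib.NumberTheory.Padics.PadicVal.Basic
import Mathlib.Data.Nat.Totient
import Mathlib.Algebra.Ring.GeomSum
import Mathlib.Algebra.BigOperators.Fin
import Mathlib.Algebra.BigOperators.Ring.Finset
import Mathlib.Algebra.BigOperators.GroupWithZero.Finset
import Mathlib.Algebra.Order.BigOperators.Ring.Finset
import Mathlib.Data.Fintype.BigOperators
import Mathlib.Algebra.Order.Field.Basic
import Mathlib.Tactic.FieldSimp
import Mathlib.Tactic.Positivity
import HarnessLib

/-!
# The Bost–Connes phase transition as unitarisability: Crisp's invariant form at finite level

[Crisp2013] realises the Bost–Connes phase transition in the representation theory of the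
adelic `ax + b` group `P_𝔸`: the representations `α_z` (`z ∈ ℂ`) on the Schwartz–Bruhat space
`𝒮(𝔸)` are *unitarisable iff `Re z ≥ 0`*; for `Re z = 0` the unitary representation is
one-dimensional, for `Re z > 0` infinite-dimensional (Lemma 2.1, p. 294). The proof (p. 295):
every translation-invariant hermitian form on `𝒮(𝔸)` is `⟨f₁, f₂⟩ = D(f₁ ∗ f₂^*)` for a tempered
distribution `D`, invariance under `α_z` forces the homogeneity `D(f(ax)) = |a|^{Re z - 1} D(f)`
(3.1), Weil's theorem makes the space of such `D` one-dimensional, and "the assertions about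
positivity and degeneracy follow from the explicit construction of these distributions"; at
`Re z = 0` the distribution is additive Haar measure = the Fourier transform of the Dirac
distribution at `0`, "so the resulting inner product is degenerate on a subspace of codimension
`1`". For `β = Re z > 0` the unitary model is `L²(𝔸, μ_β)` with `μ_β` the regular Borel measure
characterised by **(1)** `dμ_β(ax) = |a|^β dμ_β(x)` for every `a ∈ 𝔸^*` and **(2)** `μ_β(R) = 1`,
`R = ∏_p ℤ_p` (pp. 295–296; "each `μ_β` is the Fourier transform of a distribution satisfying
(3.1) with `β = Re z`").

[Neshveyev2002] (p. 3000) gives this measure explicitly: `μ_β = ⊗_p μ_{β,p}`, where `μ_{β,p}` is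
the measure on `ℚ_p` such that `μ_{1,p}` is the Haar measure (`μ_{1,p}(ℤ_p) = 1`) and
`dμ_{β,p}/dμ_{1,p}(a) = (1 - p^{-β})/(1 - p^{-1}) · |a|_p^{β-1}`; "the restriction of `μ_{β,p}`
to `ℤ_p^*` is a (non-normalized) Haar measure".

## The finite levels

`𝒮(𝔸)` is the direct limit of the finite-dimensional spaces of functions on `N⁻¹R/MR`
([Crisp2013] p. 293). On the level `M = ∏_{p ∈ S} p^{m_p}` (functions on
`R/MR ≅ ∏_{p ∈ S} ℤ/p^{m_p}`, basis the indicator functions `1_{c + MR}`), the form of the unitary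
model is the *multiplication* form of `μ_β`: its Gram matrix is **diagonal** with entries
`μ_β(c + MR) = ∏_{p ∈ S} μ_{β,p}(c_p + p^{m_p} ℤ_p)`. Integrating Neshveyev's density over a coset
(on which `|a|_p = p^{-k}`, `k = v_p(c)`, is constant when `k < m`) gives the local coset mass

  `μ_{β,p}(c + p^m ℤ_p) = p^{-mβ}`                                   if `p^m ∣ c`,
  `μ_{β,p}(c + p^m ℤ_p) = (1 - p^{-β})/(1 - p^{-1}) · p^{-kβ} · p^{k-m}`  if `k = v_p(c) < m`,

a rational function of `p^{-β}`; this file takes these formulas, for **every integer `β`**, as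
the definition `cosetMass p m β c` (the continuation in `β` of the coset masses: the finite-level
model of Weil's one-parameter family of homogeneous forms used by the construction census) and
PROVES, for all primes `p`, all levels and all integer `β`:

* §1 faithfulness to the printed characterisation: `cosetMass_one` (at `β = 1` every coset of
  level `p^m` has mass `p^{-m}`: Haar measure, `μ_{1,p}(ℤ_p) = 1`), `cosetMass_eq_density_mul`
  (for `v_p(c) < m`: mass = Neshveyev's density `(1 - p^{-β})/(1 - p^{-1}) |c|_p^{β-1}` times the
  Haar mass), `cosetMass_succ_mul` (homogeneity (1): dilation by `p` multiplies masses by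
  `p^{-β}`), `cosetMass_mul_of_not_dvd` (invariance under units), and the normalisation (2) /
  finite additivity at every level: `sum_cosetMass : ∑_{c mod p^m} μ_{β,p}(c + p^m ℤ_p) = 1`
  (an identity of rational functions of `p^{-β}`, valid for every integer `β`).
* §2 the sign law of Lemma 2.1, regime by regime, at every finite level: for `β > 0` every mass
  is positive (`cosetMass_pos`); at `β = 0` the masses are `1_{[p^m ∣ c]}` (Haar ∘ Dirac: rank
  one, `cosetMass_zero_beta`); for `β < 0` the mass of `c + p^m ℤ_p` is positive if `p^m ∣ c`
  and NEGATIVE otherwise (`cosetMass_neg_of_not_dvd`) — the form is indefinite, "`α_z` is not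
  unitarisable".
* §3 the level-`M` Gram diagonal `gramDiag S m β c = ∏_{p ∈ S} μ_{β,p}(c_p + p^{m_p} ℤ_p)` on the
  index set `∏_{p ∈ S} {0, …, p^{m_p} - 1}` (= `R/MR` by the Chinese remainder theorem): total
  mass `1` (`sum_gramDiag`), positive definite for `β > 0` (`gramDiag_pos`), the indicator of
  `c = 0` for `β = 0` (`gramDiag_zero_beta`), and for `β < 0` nondegenerate and indefinite
  with the exact inertia `n₊ - n₋ = ∏_{p ∈ S} (2 - p^{m_p})`, `n₊ + n₋ = M`
  (`card_pos_sub_card_neg_gramDiag`, `card_pos_add_card_neg_gramDiag`), i.e.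
  `n₋ = (M - ∏_{p ∈ S} (2 - p^{m_p}))/2` (`two_mul_card_neg_gramDiag`).

What is NOT here: the representations `α_z`, tempered distributions on `𝔸`, Weil's uniqueness
theorem, the measures `μ_β` as measures on `ℚ_p` (only their values on cosets of finite level),
Theorem 2.2 (irreducibility / direct-integral decomposition) and Lemma 3.2. No named facts are
introduced.

## Sources (read at the page)

* [Crisp2013] T. Crisp, *The Bost–Connes phase transition and unitary representations*,
  J. Noncommut. Geom. 7 (2013) 291–300: Lemma 2.1 (p. 294), its proof and eq. (3.1) (p. 295),
  the measures `μ_β` (pp. 295–296). Held text `paper:doi-10-4171-jncg-117`, pp. 4–6.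
* [Neshveyev2002] S. Neshveyev, *Ergodicity of the action of the positive rationals on the group
  of finite adeles and the Bost–Connes phase transition theorem*, Proc. Amer. Math. Soc. 130
  (2002) 2999–3003: the display `dμ_{β,p}/dμ_{1,p}(a) = (1 - p^{-β})/(1 - p^{-1}) |a|_p^{β-1}`
  (p. 3000). Held text `paper:arxiv-math_0002141`, chunk p0002.
-/

open Finset

namespace Literature.NumberTheory.BostConnes

namespace WeilForm

/-! ## §1 The local coset masses `μ_{β,p}(c + p^m ℤ_p)` -/

/-- The dilation factor `p^{-β} ∈ ℚ` (`β ∈ ℤ`): the modulus `|p|^β` by which `μ_{β,p}` scales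
under `x ↦ px` ([Crisp2013] (1), p. 295). [cite: Crisp2013, pp. 295–296] -/
def dilationFactor (p : ℕ) (β : ℤ) : ℚ := ((p : ℚ) ^ β)⁻¹

/-- **The local coset mass `μ_{β,p}(c + p^m ℤ_p)`** of the dilation-homogeneous functional of
degree `β` normalised by `μ_{β,p}(ℤ_p) = 1` ([Crisp2013] (1)–(2), pp. 295–296; density
`(1 - p^{-β})/(1 - p^{-1}) |a|_p^{β-1}` with respect to Haar measure, [Neshveyev2002] p. 3000):
`p^{-mβ}` if `p^m ∣ c`, and `(1 - p^{-β})/(1 - p^{-1}) · p^{-kβ} · p^{k-m}` if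
`k = v_p(c) < m`; taken as the definition for every integer `β`.
[cite: Neshveyev2002, p. 3000] -/
def cosetMass (p m : ℕ) (β : ℤ) (c : ℕ) : ℚ :=
  if p ^ m ∣ c then dilationFactor p β ^ m
  else (1 - dilationFactor p β) / (1 - (p : ℚ)⁻¹) * dilationFactor p β ^ padicValNat p c /
      (p : ℚ) ^ (m - padicValNat p c)

section Local

variable (p m : ℕ) (β : ℤ)

/-- `p^{-β} > 0`. [cite: Crisp2013, (1) p. 295] -/
theorem dilationFactor_pos (hp : 0 < p) : 0 < dilationFactor p β :=
  inv_pos.2 (zpow_pos (by exact_mod_cast hp) _)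

/-- `p^{-0} = 1`. [cite: Crisp2013, (1) p. 295] -/
@[simp] theorem dilationFactor_zero : dilationFactor p 0 = 1 := by simp [dilationFactor]

/-- `p^{-1} = 1/p` (the Haar case `β = 1`). [cite: Neshveyev2002, p. 3000] -/
@[simp] theorem dilationFactor_one : dilationFactor p 1 = (p : ℚ)⁻¹ := by simp [dilationFactor]

/-- `p^{-β} < 1` for `β > 0` (the regime `Re z > 0`). [cite: Crisp2013, Lemma 2.1] -/
theorem dilationFactor_lt_one (hp : 1 < p) (hβ : 0 < β) : dilationFactor p β < 1 :=
  inv_lt_one_of_one_lt₀ (one_lt_zpow₀ (by exact_mod_cast hp) hβ)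

/-- `p^{-β} > 1` for `β < 0` (the regime `Re z < 0`). [cite: Crisp2013, Lemma 2.1] -/
theorem one_lt_dilationFactor (hp : 1 < p) (hβ : β < 0) : 1 < dilationFactor p β := by
  rw [dilationFactor, ← zpow_neg]
  exact one_lt_zpow₀ (by exact_mod_cast hp) (by omega)

variable {p m β}

/-- Unfolding: the zero coset has mass `μ_{β,p}(p^m ℤ_p) = p^{-mβ}`.
[cite: Neshveyev2002, p. 3000] -/
theorem cosetMass_of_dvd {c : ℕ} (h : p ^ m ∣ c) : cosetMass p m β c = dilationFactor p β ^ m :=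
  if_pos h

/-- Unfolding: a coset `c + p^m ℤ_p` with `p^m ∤ c`, `k = v_p(c)`, has mass
`(1 - p^{-β})/(1 - p^{-1}) · p^{-kβ} · p^{k-m}`. [cite: Neshveyev2002, p. 3000] -/
theorem cosetMass_of_not_dvd {c : ℕ} (h : ¬p ^ m ∣ c) :
    cosetMass p m β c = (1 - dilationFactor p β) / (1 - (p : ℚ)⁻¹) *
      dilationFactor p β ^ padicValNat p c / (p : ℚ) ^ (m - padicValNat p c) :=
  if_neg h

/-- If `p^m ∤ c` then `v_p(c) < m`. [folklore] -/
private theorem padicValNat_lt_of_not_dvd {c : ℕ} (h : ¬p ^ m ∣ c) : padicValNat p c < m := by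
  by_contra hle
  exact h ((pow_dvd_pow p (not_lt.1 hle)).trans pow_padicValNat_dvd)

/-- `0 < c < p^m` implies `p^m ∤ c`. [folklore] -/
private theorem not_dvd_of_pos_of_lt {c : ℕ} (hc0 : c ≠ 0) (hc : c < p ^ m) : ¬p ^ m ∣ c :=
  fun h => absurd (Nat.le_of_dvd (Nat.pos_of_ne_zero hc0) h) (not_le.2 hc)

/-! ### Faithfulness to the printed characterisation -/

/-- **`μ_{1,p}` is the Haar measure**: at `β = 1` every coset of level `p^m` has mass `p^{-m}`
([Neshveyev2002]: "`μ_{1,p}` is the Haar measure (`μ_{1,p}(ℤ_p) = 1`)").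
[cite: Neshveyev2002, p. 3000] -/
theorem cosetMass_one [hp : Fact p.Prime] (c : ℕ) : cosetMass p m 1 c = ((p : ℚ) ^ m)⁻¹ := by
  have hp1 : (1 : ℚ) < p := by exact_mod_cast hp.out.one_lt
  have hp0 : (p : ℚ) ≠ 0 := by positivity
  have hsub : (1 : ℚ) - (p : ℚ)⁻¹ ≠ 0 := by
    have : (p : ℚ)⁻¹ < 1 := inv_lt_one_of_one_lt₀ hp1
    linarith
  by_cases h : p ^ m ∣ c
  · rw [cosetMass_of_dvd h, dilationFactor_one, inv_pow]
  · have hk := padicValNat_lt_of_not_dvd h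
    rw [cosetMass_of_not_dvd h, dilationFactor_one, div_self hsub, one_mul, inv_pow,
      div_eq_mul_inv, ← mul_inv, ← pow_add, Nat.add_sub_cancel' hk.le]

/-- **Neshveyev's density on a coset.** For `k = v_p(c) < m` the modulus `|a|_p = p^{-k}` is
constant on `c + p^m ℤ_p`, and
`μ_{β,p}(c + p^m ℤ_p) = (1 - p^{-β})/(1 - p^{-1}) · (p^{-k})^{β-1} · μ_{1,p}(c + p^m ℤ_p)`,
i.e. the coset mass is the printed density `(1 - p^{-β})/(1 - p^{-1}) |a|_p^{β-1}` integrated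
against Haar measure over the coset; here `(p^{-k})^{β-1} = (p · p^{-β})^k`.
[cite: Neshveyev2002, p. 3000] -/
theorem cosetMass_eq_density_mul [hp : Fact p.Prime] {c : ℕ} (h : ¬p ^ m ∣ c) :
    cosetMass p m β c = (1 - dilationFactor p β) / (1 - (p : ℚ)⁻¹) *
      ((p : ℚ) * dilationFactor p β) ^ padicValNat p c * cosetMass p m 1 c := by
  have hp0 : (p : ℚ) ≠ 0 := by exact_mod_cast hp.out.ne_zero
  have hk := padicValNat_lt_of_not_dvd h
  rw [cosetMass_of_not_dvd h, cosetMass_one, mul_pow]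
  have hsplit : (p : ℚ) ^ m = (p : ℚ) ^ padicValNat p c * (p : ℚ) ^ (m - padicValNat p c) := by
    rw [← pow_add, Nat.add_sub_cancel' hk.le]
  rw [hsplit]
  field_simp

/-- **Homogeneity (1) at finite level**: dilation by `p` carries the coset `c + p^m ℤ_p` onto
`pc + p^{m+1} ℤ_p`, and the mass is multiplied by `|p|_p^β = p^{-β}`
([Crisp2013] (1): `dμ_β(ax) = |a|^β dμ_β(x)`). [cite: Crisp2013, (1) p. 295] -/
theorem cosetMass_succ_mul [hp : Fact p.Prime] (c : ℕ) :
    cosetMass p (m + 1) β (p * c) = dilationFactor p β * cosetMass p m β c := by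
  have hp0 : p ≠ 0 := hp.out.ne_zero
  have hpq : (p : ℚ) ≠ 0 := by exact_mod_cast hp0
  have hdvd : p ^ (m + 1) ∣ p * c ↔ p ^ m ∣ c := by
    rw [pow_succ', Nat.mul_dvd_mul_iff_left hp.out.pos]
  by_cases h : p ^ m ∣ c
  · rw [cosetMass_of_dvd h, cosetMass_of_dvd (hdvd.2 h), pow_succ']
  · rcases eq_or_ne c 0 with rfl | hc0
    · exact absurd (dvd_zero _) h
    have hk := padicValNat_lt_of_not_dvd h
    have hv : padicValNat p (p * c) = padicValNat p c + 1 := by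
      rw [padicValNat.mul hp0 hc0, padicValNat.self hp.out.one_lt, add_comm]
    rw [cosetMass_of_not_dvd h, cosetMass_of_not_dvd (fun h' => h (hdvd.1 h')), hv,
      show m + 1 - (padicValNat p c + 1) = m - padicValNat p c by omega, pow_succ]
    ring

/-- **Invariance under units**: multiplication by `u` with `p ∤ u` permutes the cosets of level
`p^m` preserving every mass ("the restriction of `μ_{β,p}` to `ℤ_p^*` is a (non-normalized) Haar
measure", [Neshveyev2002]; `|u|_p = 1` in (1)). [cite: Neshveyev2002, p. 3000] -/
theorem cosetMass_mul_of_not_dvd [hp : Fact p.Prime] {u : ℕ} (hu : ¬p ∣ u) (c : ℕ) :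
    cosetMass p m β (u * c) = cosetMass p m β c := by
  have hu0 : u ≠ 0 := by
    rintro rfl
    exact hu (dvd_zero p)
  have hcop : Nat.Coprime (p ^ m) u :=
    (Nat.Coprime.pow_left m (hp.out.coprime_iff_not_dvd.2 hu))
  have hdvd : p ^ m ∣ u * c ↔ p ^ m ∣ c := ⟨fun h => hcop.dvd_of_dvd_mul_left h,
    fun h => Dvd.dvd.mul_left h u⟩
  by_cases h : p ^ m ∣ c
  · rw [cosetMass_of_dvd h, cosetMass_of_dvd (hdvd.2 h)]
  · rcases eq_or_ne c 0 with rfl | hc0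
    · exact absurd (dvd_zero _) h
    have hv : padicValNat p (u * c) = padicValNat p c := by
      rw [padicValNat.mul hu0 hc0, padicValNat.eq_zero_of_not_dvd hu, zero_add]
    rw [cosetMass_of_not_dvd h, cosetMass_of_not_dvd (fun h' => h (hdvd.1 h')), hv]

/-! ### Finite additivity / normalisation `μ_{β,p}(ℤ_p) = 1` at every level -/

/-- The number of residues `c` modulo `p^m` with `v_p(c) = k` (`k < m`, `c ≠ 0`) is
`φ(p^{m-k}) = p^{m-k-1}(p - 1)` (they are the `p^k u`, `u` a unit modulo `p^{m-k}`).
[folklore] -/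
private theorem card_filter_padicValNat_eq [hp : Fact p.Prime] {k : ℕ} (hk : k < m) :
    #{c ∈ range (p ^ m) | c ≠ 0 ∧ padicValNat p c = k} = p ^ (m - k - 1) * (p - 1) := by
  have hP := hp.out
  have hp0 : p ≠ 0 := hP.ne_zero
  have hpk : p ^ k ≠ 0 := pow_ne_zero _ hp0
  obtain ⟨j, hm, hj0⟩ : ∃ j, m = k + j ∧ 0 < j := ⟨m - k, by omega, by omega⟩
  have hT : #{u ∈ range (p ^ j) | ¬p ∣ u} = p ^ (j - 1) * (p - 1) := by
    rw [← Nat.totient_prime_pow hP hj0, Nat.totient_eq_card_coprime]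
    congr 1
    refine filter_congr fun u _ => ?_
    rw [Nat.coprime_pow_left_iff hj0, hP.coprime_iff_not_dvd]
  have himage : ({c ∈ range (p ^ m) | c ≠ 0 ∧ padicValNat p c = k} : Finset ℕ) =
      ({u ∈ range (p ^ j) | ¬p ∣ u} : Finset ℕ).image (fun u => p ^ k * u) := by
    ext c
    simp only [mem_filter, mem_range, mem_image]
    constructor
    · rintro ⟨hc, hc0, hv⟩
      obtain ⟨u, rfl⟩ : p ^ k ∣ c := hv ▸ pow_padicValNat_dvd
      have hu0 : u ≠ 0 := by
        rintro rfl
        exact hc0 (mul_zero _)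
      refine ⟨u, ⟨?_, ?_⟩, rfl⟩
      · rw [hm, pow_add] at hc
        exact Nat.lt_of_mul_lt_mul_left hc
      · intro hpu
        have hv' : padicValNat p (p ^ k * u) = k + padicValNat p u := by
          rw [padicValNat.mul hpk hu0, padicValNat.prime_pow]
        have h1 := one_le_padicValNat_of_dvd hu0 hpu
        omega
    · rintro ⟨u, ⟨hu, hpu⟩, rfl⟩
      have hu0 : u ≠ 0 := by
        rintro rfl
        exact hpu (dvd_zero p)
      refine ⟨?_, mul_ne_zero hpk hu0, ?_⟩
      · rw [hm, pow_add]
        exact Nat.mul_lt_mul_of_pos_left hu (Nat.pos_of_ne_zero hpk)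
      · rw [padicValNat.mul hpk hu0, padicValNat.prime_pow, padicValNat.eq_zero_of_not_dvd hpu,
          add_zero]
  rw [himage, card_image_of_injective _ fun a b hab => Nat.eq_of_mul_eq_mul_left
    (Nat.pos_of_ne_zero hpk) hab, hT]
  congr 2
  omega

/-- **Normalisation (2) / finite additivity at level `p^m`**:
`∑_{c mod p^m} μ_{β,p}(c + p^m ℤ_p) = μ_{β,p}(ℤ_p) = 1`, for every prime `p`, every `m` and
every integer `β` — the masses `p^{-mβ}` (for `c ≡ 0`) and `φ(p^{m-k})` copies of
`(1 - p^{-β})/(1 - p^{-1}) p^{-kβ} p^{k-m} ` (for `v_p(c) = k < m`) telescope: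
`p^{-mβ} + ∑_{k<m} (1 - p^{-β}) p^{-kβ} = 1` ([Crisp2013] (2) `μ_β(R) = 1`; [Neshveyev2002]
`μ_{1,p}(ℤ_p) = 1` and the density integrates to `1`). [cite: Crisp2013, (2) p. 295] -/
theorem sum_cosetMass [hp : Fact p.Prime] :
    ∑ c ∈ range (p ^ m), cosetMass p m β c = 1 := by
  have hP := hp.out
  have hp1 : (1 : ℚ) < p := by exact_mod_cast hP.one_lt
  have hp0 : (p : ℚ) ≠ 0 := by positivity
  set x := dilationFactor p β with hx
  have h0 : (0 : ℕ) ∈ range (p ^ m) := mem_range.2 (pow_pos hP.pos m)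
  rw [← add_sum_erase _ _ h0, cosetMass_of_dvd (dvd_zero _)]
  have hmaps : ∀ c ∈ (range (p ^ m)).erase 0, padicValNat p c ∈ range m := by
    intro c hc
    rw [mem_erase, mem_range] at hc
    exact mem_range.2 (padicValNat_lt_of_not_dvd (not_dvd_of_pos_of_lt hc.1 hc.2))
  rw [← sum_fiberwise_of_maps_to hmaps]
  have hinner : ∀ k ∈ range m,
      ∑ c ∈ (range (p ^ m)).erase 0 with padicValNat p c = k, cosetMass p m β c =
        (1 - x) * x ^ k := by
    intro k hk
    rw [mem_range] at hk
    have hconst : ∀ c ∈ ((range (p ^ m)).erase 0).filter (fun c => padicValNat p c = k),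
        cosetMass p m β c = (1 - x) / (1 - (p : ℚ)⁻¹) * x ^ k / (p : ℚ) ^ (m - k) := by
      intro c hc
      simp only [mem_filter, mem_erase, mem_range] at hc
      obtain ⟨⟨hc0, hcm⟩, hv⟩ := hc
      rw [cosetMass_of_not_dvd (not_dvd_of_pos_of_lt hc0 hcm), hv]
    rw [sum_congr rfl hconst, sum_const]
    have hcard : #(((range (p ^ m)).erase 0).filter (fun c => padicValNat p c = k)) =
        p ^ (m - k - 1) * (p - 1) := by
      rw [← card_filter_padicValNat_eq hk]
      congr 1
      ext c
      simp only [mem_filter, mem_erase, mem_range, ne_eq]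
      tauto
    rw [hcard, nsmul_eq_mul]
    have hsplit : (p : ℚ) ^ (m - k) = (p : ℚ) ^ (m - k - 1) * p := by
      rw [← pow_succ, show m - k - 1 + 1 = m - k by omega]
    have hsub : (1 : ℚ) - (p : ℚ)⁻¹ ≠ 0 := by
      have : (p : ℚ)⁻¹ < 1 := inv_lt_one_of_one_lt₀ hp1
      linarith
    have hsub' : (p : ℚ) - 1 ≠ 0 := by
      intro h0
      have : (p : ℚ) = 1 := by linarith
      exact absurd this (ne_of_gt hp1)
    have hinv : (1 : ℚ) - (p : ℚ)⁻¹ = ((p : ℚ) - 1) / p := by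
      field_simp
    rw [hsplit, hinv]
    push_cast [Nat.cast_sub hP.one_le]
    field_simp
  rw [sum_congr rfl hinner, ← mul_sum, mul_comm, geom_sum_mul_neg]
  ring

/-! ## §2 The sign law of Lemma 2.1 at finite level -/

/-- The coset of `0` always has positive mass `p^{-mβ} > 0`. [cite: Crisp2013, Lemma 2.1] -/
theorem cosetMass_pos_of_dvd (hp : 0 < p) {c : ℕ} (h : p ^ m ∣ c) : 0 < cosetMass p m β c := by
  rw [cosetMass_of_dvd h]
  exact pow_pos (dilationFactor_pos p β hp) m

/-- **`Re z > 0`: the form is positive definite at every finite level** — for `β > 0` every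
coset has strictly positive mass ([Crisp2013] Lemma 2.1: "If `Re z ≥ 0`, then `α_z` is
unitarisable"; `μ_β` is a measure). [cite: Crisp2013, Lemma 2.1] -/
theorem cosetMass_pos [hp : Fact p.Prime] (hβ : 0 < β) (c : ℕ) : 0 < cosetMass p m β c := by
  have hP := hp.out
  have hp1 : (1 : ℚ) < p := by exact_mod_cast hP.one_lt
  by_cases h : p ^ m ∣ c
  · exact cosetMass_pos_of_dvd hP.pos h
  · rw [cosetMass_of_not_dvd h]
    have hx0 : 0 < dilationFactor p β := dilationFactor_pos p β hP.pos
    have hx1 : dilationFactor p β < 1 := dilationFactor_lt_one p β hP.one_lt hβ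
    have hsub : 0 < (1 : ℚ) - (p : ℚ)⁻¹ := by
      have : (p : ℚ)⁻¹ < 1 := inv_lt_one_of_one_lt₀ hp1
      linarith
    have : 0 < 1 - dilationFactor p β := by linarith
    positivity

/-- **`Re z = 0`: Haar ∘ Dirac, rank one** — at `β = 0` the mass of `c + p^m ℤ_p` is `1` if
`p^m ∣ c` and `0` otherwise: the form is the degenerate rank-one form `f ↦ |f̂(0)|²`
([Crisp2013] p. 295: "for `Re z = 0` the distribution in question is additive Haar measure, or
in other words the Fourier transform of the Dirac distribution at `0`, and so the resulting
inner product is degenerate on a subspace of codimension `1`"). [cite: Crisp2013, Lemma 2.1] -/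
theorem cosetMass_zero_beta (c : ℕ) : cosetMass p m 0 c = if p ^ m ∣ c then 1 else 0 := by
  by_cases h : p ^ m ∣ c
  · rw [cosetMass_of_dvd h, if_pos h, dilationFactor_zero, one_pow]
  · rw [cosetMass_of_not_dvd h, if_neg h, dilationFactor_zero, sub_self, zero_div, zero_mul,
      zero_div]

/-- **`Re z < 0`: not unitarisable** — for `β < 0` every coset `c + p^m ℤ_p` with `p^m ∤ c` has
strictly NEGATIVE mass (the factor `1 - p^{-β} < 0`), while the coset of `0` has positive mass:
the invariant form of level `p^m` (`m ≥ 1`) is indefinite ([Crisp2013] Lemma 2.1: "If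
`Re z < 0`, `α_z` is not unitarisable"). [cite: Crisp2013, Lemma 2.1] -/
theorem cosetMass_neg_of_not_dvd [hp : Fact p.Prime] (hβ : β < 0) {c : ℕ} (h : ¬p ^ m ∣ c) :
    cosetMass p m β c < 0 := by
  have hP := hp.out
  have hp1 : (1 : ℚ) < p := by exact_mod_cast hP.one_lt
  rw [cosetMass_of_not_dvd h]
  have hx0 : 0 < dilationFactor p β := dilationFactor_pos p β hP.pos
  have hx1 : 1 < dilationFactor p β := one_lt_dilationFactor p β hP.one_lt hβ
  have hsub : 0 < (1 : ℚ) - (p : ℚ)⁻¹ := by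
    have : (p : ℚ)⁻¹ < 1 := inv_lt_one_of_one_lt₀ hp1
    linarith
  have hneg : (1 - dilationFactor p β) / (1 - (p : ℚ)⁻¹) < 0 :=
    div_neg_of_neg_of_pos (by linarith) hsub
  have hpos : 0 < dilationFactor p β ^ padicValNat p c / (p : ℚ) ^ (m - padicValNat p c) := by
    positivity
  rw [mul_div_assoc]
  exact mul_neg_of_neg_of_pos hneg hpos

end Local

/-! ## §3 The Gram diagonal of the level `M = ∏_{p ∈ S} p^{m_p}` -/

section Level

variable (S : Finset ℕ) (m : ℕ → ℕ) (β : ℤ)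

/-- The index set of the level `M = ∏_{p ∈ S} p^{m_p}`: tuples of residues `(c_p)_{p ∈ S}` with
`0 ≤ c_p < p^{m_p}`, i.e. `∏_{p ∈ S} ℤ/p^{m_p} ≅ R/MR` (Chinese remainder theorem); it indexes the
basis `1_{c + MR}` of the level-`M` subspace of `𝒮(𝔸)` ([Crisp2013] p. 293).
[cite: Crisp2013, p. 293] -/
abbrev LevelIndex : Type := (p : S) → Fin ((p : ℕ) ^ m p)

/-- **The Gram diagonal of level `M`.** The multiplication form of `μ_β = ⊗_p μ_{β,p}` on the
indicator basis `1_{c + MR}` is diagonal (distinct cosets are disjoint) with entries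
`⟨1_{c+MR}, 1_{c+MR}⟩ = μ_β(c + MR) = ∏_{p ∈ S} μ_{β,p}(c_p + p^{m_p} ℤ_p)`.
[cite: Crisp2013, pp. 295–296] -/
def gramDiag (c : LevelIndex S m) : ℚ := ∏ p : S, cosetMass (p : ℕ) (m p) β (c p : ℕ)

/-- The sign `+1` on the zero coset and `-1` on every other coset of level `p^n` — the sign
pattern of `μ_{β,p}` for `β < 0` (`cosetMass_neg_of_not_dvd`). [cite: Crisp2013, Lemma 2.1] -/
def localSign (p n : ℕ) (i : Fin (p ^ n)) : ℤ := if (i : ℕ) = 0 then 1 else -1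

/-- The sign of the level-`M` Gram entry at `c` for `β < 0`: `∏_{p ∈ S} localSign`, i.e.
`(-1)^{#{p ∈ S : c_p ≠ 0}}`. [cite: Crisp2013, Lemma 2.1] -/
def levelSign (c : LevelIndex S m) : ℤ := ∏ p : S, localSign (p : ℕ) (m p) (c p)

variable {S m β}

/-- For a residue `0 ≤ i < p^n`: `p^n ∣ i ↔ i = 0`. [folklore] -/
private theorem dvd_fin_iff {p n : ℕ} (i : Fin (p ^ n)) : p ^ n ∣ (i : ℕ) ↔ (i : ℕ) = 0 := by
  constructor
  · intro h
    by_contra h0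
    exact not_dvd_of_pos_of_lt h0 i.2 h
  · intro h
    rw [h]
    exact dvd_zero _

/-- A local sign is `±1`. [cite: Crisp2013, Lemma 2.1] -/
theorem localSign_eq_one_or (p n : ℕ) (i : Fin (p ^ n)) :
    localSign p n i = 1 ∨ localSign p n i = -1 := by
  unfold localSign
  split_ifs <;> simp

/-- A level sign is `±1`. [cite: Crisp2013, Lemma 2.1] -/
theorem levelSign_eq_one_or (c : LevelIndex S m) : levelSign S m c = 1 ∨ levelSign S m c = -1 := by
  unfold levelSign
  refine Finset.prod_induction _ (fun x => x = 1 ∨ x = -1) ?_ (Or.inl rfl) ?_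
  · rintro a b (rfl | rfl) (rfl | rfl) <;> simp
  · intro p _
    exact localSign_eq_one_or _ _ _

/-- For `β < 0` each local mass is its sign times its absolute value.
[cite: Crisp2013, Lemma 2.1] -/
theorem cosetMass_fin_eq_localSign_mul_abs {p n : ℕ} [hp : Fact p.Prime] (hβ : β < 0)
    (i : Fin (p ^ n)) :
    cosetMass p n β i = (localSign p n i : ℚ) * |cosetMass p n β i| := by
  unfold localSign
  split_ifs with h
  · have hpos : 0 < cosetMass p n β i :=
      cosetMass_pos_of_dvd hp.out.pos ((dvd_fin_iff i).2 h)
    rw [Int.cast_one, one_mul, abs_of_pos hpos]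
  · have hneg := cosetMass_neg_of_not_dvd (m := n) hβ (fun h' => h ((dvd_fin_iff i).1 h'))
    push_cast
    rw [abs_of_neg hneg]
    ring

/-- **Total mass `1` at every level**: `∑_{c ∈ R/MR} μ_β(c + MR) = μ_β(R) = 1`
([Crisp2013] (2)), for every finite set of primes `S`, all exponents and every integer `β`.
[cite: Crisp2013, (2) p. 295] -/
theorem sum_gramDiag (hS : ∀ p ∈ S, p.Prime) : ∑ c : LevelIndex S m, gramDiag S m β c = 1 := by
  have h := Fintype.prod_sum
    (fun (p : S) (j : Fin ((p : ℕ) ^ m p)) => cosetMass (p : ℕ) (m p) β (j : ℕ))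
  unfold gramDiag
  rw [← h]
  refine Finset.prod_eq_one fun p _ => ?_
  haveI : Fact (p : ℕ).Prime := ⟨hS p p.2⟩
  rw [Fin.sum_univ_eq_sum_range (fun c => cosetMass (p : ℕ) (m p) β c) ((p : ℕ) ^ m p)]
  exact sum_cosetMass

/-- **`Re z > 0`: positive definite** — for `β > 0` every diagonal Gram entry of every level
is strictly positive (inertia `(M, 0, 0)`). [cite: Crisp2013, Lemma 2.1] -/
theorem gramDiag_pos (hS : ∀ p ∈ S, p.Prime) (hβ : 0 < β) (c : LevelIndex S m) :
    0 < gramDiag S m β c :=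
  Finset.prod_pos fun p _ => by
    haveI : Fact (p : ℕ).Prime := ⟨hS p p.2⟩
    exact cosetMass_pos hβ _

/-- **`Re z = 0`: rank one** — at `β = 0` the Gram diagonal is the indicator of the zero
tuple `c = 0` (the form `f ↦ |f̂(0)|²`, "degenerate on a subspace of codimension `1`").
[cite: Crisp2013, Lemma 2.1] -/
theorem gramDiag_zero_beta (c : LevelIndex S m) :
    gramDiag S m 0 c = if ∀ p : S, (c p : ℕ) = 0 then 1 else 0 := by
  unfold gramDiag
  simp_rw [cosetMass_zero_beta]
  have h : ∀ p : S, (if (p : ℕ) ^ m p ∣ (c p : ℕ) then (1 : ℚ) else 0) =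
      if (c p : ℕ) = 0 then 1 else 0 := fun p => if_congr (dvd_fin_iff (c p)) rfl rfl
  simp_rw [h]
  exact Fintype.prod_boole

/-- At `β = 0` exactly one Gram entry is positive (the zero coset, value `1`) and all others
vanish: inertia `(1, M - 1, 0)`. [cite: Crisp2013, Lemma 2.1] -/
theorem card_filter_pos_gramDiag_zero_beta (hS : ∀ p ∈ S, p.Prime) :
    #{c : LevelIndex S m | 0 < gramDiag S m 0 c} = 1 ∧
      #{c : LevelIndex S m | gramDiag S m 0 c < 0} = 0 := by
  have hpn : ∀ p : S, 0 < (p : ℕ) ^ m p := fun p => pow_pos (hS p p.2).pos _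
  constructor
  · rw [Finset.card_eq_one]
    refine ⟨fun p => ⟨0, hpn p⟩, ?_⟩
    ext c
    simp only [mem_filter, mem_univ, true_and, mem_singleton, gramDiag_zero_beta]
    constructor
    · intro h
      split_ifs at h with hall
      · funext p
        exact Fin.ext (hall p)
      · exact absurd h (lt_irrefl 0)
    · rintro rfl
      rw [if_pos fun p => rfl]
      exact one_pos
  · rw [Finset.card_eq_zero, Finset.filter_eq_empty_iff]
    intro c _
    rw [gramDiag_zero_beta]
    split_ifs <;> norm_num

/-- For `β < 0` the level-`M` Gram entry at `c` is its sign `levelSign c = (-1)^{#{p : c_p ≠ 0}}`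
times its absolute value. [cite: Crisp2013, Lemma 2.1] -/
theorem gramDiag_eq_levelSign_mul_abs (hS : ∀ p ∈ S, p.Prime) (hβ : β < 0)
    (c : LevelIndex S m) :
    gramDiag S m β c = (levelSign S m c : ℚ) * |gramDiag S m β c| := by
  unfold gramDiag levelSign
  rw [Finset.abs_prod, Int.cast_prod, ← Finset.prod_mul_distrib]
  refine Finset.prod_congr rfl fun p _ => ?_
  haveI : Fact (p : ℕ).Prime := ⟨hS p p.2⟩
  exact cosetMass_fin_eq_localSign_mul_abs hβ (c p)

/-- For `β < 0` the form of every level is nondegenerate: no Gram entry vanishes.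
[cite: Crisp2013, Lemma 2.1] -/
theorem gramDiag_ne_zero (hS : ∀ p ∈ S, p.Prime) (hβ : β < 0) (c : LevelIndex S m) :
    gramDiag S m β c ≠ 0 := by
  unfold gramDiag
  refine Finset.prod_ne_zero_iff.2 fun p _ => ?_
  haveI : Fact (p : ℕ).Prime := ⟨hS p p.2⟩
  by_cases h : (p : ℕ) ^ m p ∣ (c p : ℕ)
  · exact (cosetMass_pos_of_dvd (Fact.out : (p : ℕ).Prime).pos h).ne'
  · exact (cosetMass_neg_of_not_dvd hβ h).ne

/-- For `β < 0`: the Gram entry at `c` is positive iff an even number of the components `c_p`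
are nonzero (`levelSign c = 1`). [cite: Crisp2013, Lemma 2.1] -/
theorem gramDiag_pos_iff (hS : ∀ p ∈ S, p.Prime) (hβ : β < 0) (c : LevelIndex S m) :
    0 < gramDiag S m β c ↔ levelSign S m c = 1 := by
  have habs : 0 < |gramDiag S m β c| := abs_pos.2 (gramDiag_ne_zero hS hβ c)
  have heq := gramDiag_eq_levelSign_mul_abs hS hβ c
  rcases levelSign_eq_one_or c with h1 | h1
  · rw [h1, Int.cast_one, one_mul] at heq
    exact ⟨fun _ => h1, fun _ => heq ▸ habs⟩
  · rw [h1] at heq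
    push_cast at heq
    constructor
    · intro h
      rw [heq] at h
      linarith
    · intro h
      rw [h1] at h
      norm_num at h

/-- For `β < 0`: the Gram entry at `c` is negative iff an odd number of the components `c_p`
are nonzero (`levelSign c = -1`). [cite: Crisp2013, Lemma 2.1] -/
theorem gramDiag_neg_iff (hS : ∀ p ∈ S, p.Prime) (hβ : β < 0) (c : LevelIndex S m) :
    gramDiag S m β c < 0 ↔ levelSign S m c = -1 := by
  have habs : 0 < |gramDiag S m β c| := abs_pos.2 (gramDiag_ne_zero hS hβ c)
  have heq := gramDiag_eq_levelSign_mul_abs hS hβ c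
  rcases levelSign_eq_one_or c with h1 | h1
  · rw [h1, Int.cast_one, one_mul] at heq
    constructor
    · intro h
      rw [heq] at h
      linarith
    · intro h
      rw [h1] at h
      norm_num at h
  · rw [h1] at heq
    push_cast at heq
    exact ⟨fun _ => h1, fun _ => by rw [heq]; linarith⟩

/-- `∑_{c mod p^n} localSign(c) = 1 - (p^n - 1) = 2 - p^n`. [folklore] -/
private theorem sum_localSign {p : ℕ} (hp : 0 < p) (n : ℕ) :
    ∑ i : Fin (p ^ n), localSign p n i = 2 - (p : ℤ) ^ n := by
  have hpn : 0 < p ^ n := pow_pos hp n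
  have key : ∀ i : Fin (p ^ n),
      localSign p n i = (if i = ⟨0, hpn⟩ then (2 : ℤ) else 0) - 1 := by
    intro i
    unfold localSign
    by_cases h : (i : ℕ) = 0
    · have hi : i = ⟨0, hpn⟩ := Fin.ext h
      rw [if_pos h, if_pos hi]
      norm_num
    · have hi : i ≠ ⟨0, hpn⟩ := fun h' => h (by rw [h'])
      rw [if_neg h, if_neg hi]
      norm_num
  rw [Finset.sum_congr rfl fun i _ => key i, Finset.sum_sub_distrib]
  simp only [Finset.sum_ite_eq', Finset.mem_univ, if_true, Finset.sum_const, Finset.card_univ,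
    Fintype.card_fin, nsmul_eq_mul, mul_one]
  push_cast
  ring

/-- `∑_{c ∈ R/MR} levelSign(c) = ∏_{p ∈ S} (2 - p^{m_p})`. [folklore] -/
private theorem sum_levelSign (hS : ∀ p ∈ S, p.Prime) :
    ∑ c : LevelIndex S m, levelSign S m c = ∏ p ∈ S, (2 - (p : ℤ) ^ m p) := by
  have h := Fintype.prod_sum (fun (p : S) (j : Fin ((p : ℕ) ^ m p)) => localSign (p : ℕ) (m p) j)
  unfold levelSign
  rw [← h, ← Finset.prod_coe_sort S]
  exact Finset.prod_congr rfl fun p _ => sum_localSign (hS p p.2).pos _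

/-- **`Re z < 0`: the exact inertia of the level-`M` form.** For `β < 0`, with
`n₊ = #{c : μ_β(c + MR) > 0}` and `n₋ = #{c : μ_β(c + MR) < 0}`:
`n₊ - n₋ = ∑_c (-1)^{#{p : c_p ≠ 0}} = ∏_{p ∈ S} (1 - (p^{m_p} - 1)) = ∏_{p ∈ S} (2 - p^{m_p})`.
[cite: Crisp2013, Lemma 2.1] -/
theorem card_pos_sub_card_neg_gramDiag (hS : ∀ p ∈ S, p.Prime) (hβ : β < 0) :
    (#{c : LevelIndex S m | 0 < gramDiag S m β c} : ℤ) -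
        #{c : LevelIndex S m | gramDiag S m β c < 0} =
      ∏ p ∈ S, (2 - (p : ℤ) ^ m p) := by
  rw [← sum_levelSign hS, ← Finset.sum_filter_add_sum_filter_not (s := Finset.univ)
    (p := fun c => levelSign S m c = 1)]
  have hf1 : Finset.univ.filter (fun c : LevelIndex S m => levelSign S m c = 1) =
      Finset.univ.filter (fun c : LevelIndex S m => 0 < gramDiag S m β c) :=
    Finset.filter_congr fun c _ => (gramDiag_pos_iff hS hβ c).symm
  have hf2 : Finset.univ.filter (fun c : LevelIndex S m => ¬levelSign S m c = 1) =
      Finset.univ.filter (fun c : LevelIndex S m => gramDiag S m β c < 0) := by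
    refine Finset.filter_congr fun c _ => ?_
    rw [gramDiag_neg_iff hS hβ c]
    constructor
    · intro h
      rcases levelSign_eq_one_or c with h' | h'
      · exact absurd h' h
      · exact h'
    · intro h
      rw [h]
      decide
  have h1 : ∑ c ∈ Finset.univ.filter (fun c : LevelIndex S m => levelSign S m c = 1),
      levelSign S m c = (#{c : LevelIndex S m | 0 < gramDiag S m β c} : ℤ) := by
    rw [Finset.sum_congr rfl (fun c hc => (Finset.mem_filter.1 hc).2), Finset.sum_const,
      nsmul_eq_mul, mul_one, hf1]
  have h2 : ∑ c ∈ Finset.univ.filter (fun c : LevelIndex S m => ¬levelSign S m c = 1),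
      levelSign S m c = -(#{c : LevelIndex S m | gramDiag S m β c < 0} : ℤ) := by
    have hval : ∀ c ∈ Finset.univ.filter (fun c : LevelIndex S m => ¬levelSign S m c = 1),
        levelSign S m c = -1 := by
      intro c hc
      rcases levelSign_eq_one_or c with h | h
      · exact absurd h (Finset.mem_filter.1 hc).2
      · exact h
    rw [Finset.sum_congr rfl hval, Finset.sum_const, nsmul_eq_mul, mul_neg, mul_one, hf2]
  rw [h1, h2]
  ring

/-- For `β < 0`: `n₊ + n₋ = M = ∏_{p ∈ S} p^{m_p}` (no Gram entry vanishes).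
[cite: Crisp2013, Lemma 2.1] -/
theorem card_pos_add_card_neg_gramDiag (hS : ∀ p ∈ S, p.Prime) (hβ : β < 0) :
    #{c : LevelIndex S m | 0 < gramDiag S m β c} + #{c : LevelIndex S m | gramDiag S m β c < 0} =
      ∏ p ∈ S, p ^ m p := by
  rw [← Finset.card_union_of_disjoint]
  · have hunion : Finset.univ.filter (fun c : LevelIndex S m => 0 < gramDiag S m β c) ∪
        Finset.univ.filter (fun c : LevelIndex S m => gramDiag S m β c < 0) = Finset.univ := by
      ext c
      simp only [Finset.mem_union, Finset.mem_filter, Finset.mem_univ, true_and, iff_true]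
      rcases lt_trichotomy (gramDiag S m β c) 0 with h | h | h
      · exact Or.inr h
      · exact absurd h (gramDiag_ne_zero hS hβ c)
      · exact Or.inl h
    rw [hunion, Finset.card_univ, Fintype.card_pi, ← Finset.prod_coe_sort S]
    exact Finset.prod_congr rfl fun p _ => Fintype.card_fin _
  · rw [Finset.disjoint_filter]
    intro c _ h1 h2
    exact lt_asymm h1 h2

/-- **The negative index of the level-`M` form for `β < 0`**:
`2 n₋ = M - ∏_{p ∈ S} (2 - p^{m_p})`, i.e. `n₋ = (M - ∏_{p ∈ S}(2 - p^{m_p}))/2 ≥ 1` as soon as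
`S ≠ ∅` and all `m_p ≥ 1` — the invariant form is indefinite ("not unitarisable").
[cite: Crisp2013, Lemma 2.1] -/
theorem two_mul_card_neg_gramDiag (hS : ∀ p ∈ S, p.Prime) (hβ : β < 0) :
    2 * (#{c : LevelIndex S m | gramDiag S m β c < 0} : ℤ) =
      ∏ p ∈ S, (p : ℤ) ^ m p - ∏ p ∈ S, (2 - (p : ℤ) ^ m p) := by
  have h1 := card_pos_sub_card_neg_gramDiag (S := S) (m := m) hS hβ
  have h2 := card_pos_add_card_neg_gramDiag (S := S) (m := m) hS hβ
  have h2' : (#{c : LevelIndex S m | 0 < gramDiag S m β c} : ℤ) +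
      #{c : LevelIndex S m | gramDiag S m β c < 0} = ∏ p ∈ S, (p : ℤ) ^ m p := by
    exact_mod_cast h2
  linarith

/-- For `β < 0` no Gram entry vanishes: `n₀ = 0`. [cite: Crisp2013, Lemma 2.1] -/
theorem card_filter_gramDiag_eq_zero (hS : ∀ p ∈ S, p.Prime) (hβ : β < 0) :
    #{c : LevelIndex S m | gramDiag S m β c = 0} = 0 := by
  rw [Finset.card_eq_zero, Finset.filter_eq_empty_iff]
  exact fun c _ => gramDiag_ne_zero hS hβ c

end Level

end WeilForm

end Literature.NumberTheory.BostConnes
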